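import Summits.NavierStokesRegularity.NavierStokesRegularity.Theorems.FilamentSkeletonRssSkeletonJ1RUnstableEigenPersistence
import Summits.NavierStokesRegularity.NavierStokesRegularity.Theorems.FilamentSkeletonRssSkeletonJ1RUnstableCurveSpectral

/-!
# Route `FilamentSkeletonRss` · crux `SkeletonJ1R` (stmt-NavierStokesRegularity-23610) · registered line `streamline_kantorovich_R`
# — brick K-§3f for stub K `KantorovichClosingL`: THE UNSTABLE EIGEN-DATA `(ξ, ℓ, λ, β)` OF A PERTURBED MODEL BLOCK, AND THE UNSTABLE CURVE
# FROM MODEL DATA + A NORM BOUND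

Hand `ns-filament-21221-p1` (g18), `--supports stmt-NavierStokesRegularity-23610 --as helper`; pure Mathlib + the landed K-§3 bricks, route-independent.

WHAT.  On a real Hilbert space `E` let the MODEL operator `A₀` be orthogonally split along a unit vector `ξ₀`: `A₀ ξ₀ = λ₀ ξ₀`, `ξ₀^⊥` is
`A₀`-invariant, and `⟪A₀ u, u⟫ ≤ β₀ ‖u‖²` on `ξ₀^⊥` with gap `γ = λ₀ − β₀ > 0` (the clause-12 waist block: slip slope `λ₀` on the tangent,
swirl + contracting strain on the normal plane).  Let `‖A − A₀‖ ≤ ε` with `36 ε ≤ γ`.  Then (`exists_unstableEigenData`) `A` has a right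
eigenvector `ξ` (`‖ξ − ξ₀‖ ≤ 6ε/γ`), a left eigenvector `ℓ` (`ℓ ∘ A = λ ℓ`, `ℓ ξ = 1`) for a real eigenvalue `λ`, `|λ − λ₀| ≤ 2ε`, and the
numerical-range bound `⟪A v, v⟫ ≤ β ‖v‖²` on `ker ℓ` with `β ≤ β₀ + 2ε ≤ λ` — exactly the hypotheses of
`exists_unstableCurve_of_leftEigenvector` (`…UnstableCurveSpectral`).  PROOF: the right eigenvector from
`exists_eigenvector_of_norm_le` (`…UnstableEigenPersistence`); the left one from the same theorem applied to the ADJOINTS `A₀†, ContinuousLinearMap.adjoint B` (same block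
structure, `‖ContinuousLinearMap.adjoint B‖ = ‖B‖`), `ℓ = ⟪z, ·⟫/⟪z, ξ⟫` with `⟪z, ξ⟫ ≥ 1 − (6ε/γ)²`; `λ' = λ` because `ℓ(Aξ) = λ = λ'`; on `ker ℓ` the `ξ₀`-component of
`v` is `−⟪w', v⟫ = O(ε)‖v‖`, whence `⟪A v, v⟫ ≤ (β₀ + γ(6ε/γ)² + ε)‖v‖²`.
PACKAGED (`exists_unstableCurve_of_model`): the `C¹` unstable curve of `f` at `p` (`λ s P′ = f(P)`, `P(0) = p`, `P′(0) = ξ`, cone bounds) from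
`f p = 0`, `Df` Lipschitz at `p`, the MODEL data `(A₀, ξ₀, λ₀, β₀)` and `‖Df(p) − A₀‖ ≤ ε` — what K checks at the waist zero BY NAME.

HONEST FRAMING.  Linear-algebra bookkeeping for a sub-brick of the OPEN stub K of the ∃-side of a HYPOTHETICAL filament-type rotating-self-similar
blow-up skeleton (MODEL rung, negative side); stub K, the crux 23610 and its heart stay OPEN; nothing here is a claim about Navier–Stokes regularity
or blow-up.  References: Kato (1966) II §2 (perturbation of a simple eigenvalue and its eigenprojection).
-/

set_option linter.dupNamespace false -- `NavierStokesRegularity.NavierStokesRegularity` path/namespace repetition is the tree convention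

noncomputable section

namespace Summit.NavierStokesRegularity.NavierStokesRegularity.Theorems.SkeletonJ1RUnstableCurve

open Set Function Filter Metric NormedSpace
open scoped Topology InnerProductSpace

variable {E : Type*} [NormedAddCommGroup E] [InnerProductSpace ℝ E] [CompleteSpace E]

/-! ## §1 The adjoint has the same block structure -/

/-- If `‖ξ₀‖ = 1`, `A₀ ξ₀ = λ₀ ξ₀` and `ξ₀^⊥` is `A₀`-invariant, then `A₀† ξ₀ = λ₀ ξ₀`. [folklore] -/
theorem adjoint_apply_eq_of_invariant {A₀ : E →L[ℝ] E} {ξ₀ : E} {lam₀ : ℝ} (hξ₀ : ‖ξ₀‖ = 1) (hA₀ξ₀ : A₀ ξ₀ = lam₀ • ξ₀)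
    (hinv : ∀ u, ⟪ξ₀, u⟫_ℝ = 0 → ⟪ξ₀, A₀ u⟫_ℝ = 0) : (ContinuousLinearMap.adjoint A₀) ξ₀ = lam₀ • ξ₀ := by
  have hξξ : ⟪ξ₀, ξ₀⟫_ℝ = 1 := by rw [real_inner_self_eq_norm_sq, hξ₀, one_pow]
  apply ext_inner_right ℝ
  intro v
  rw [ContinuousLinearMap.adjoint_inner_left]
  set c := ⟪ξ₀, v⟫_ℝ with hc
  have hu : ⟪ξ₀, v - c • ξ₀⟫_ℝ = 0 := by rw [inner_sub_right, inner_smul_right, hξξ, mul_one, hc, sub_self]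
  have hsplit : v = (v - c • ξ₀) + c • ξ₀ := by abel
  conv_lhs => rw [hsplit]
  rw [map_add, map_smul, hA₀ξ₀, inner_add_right, hinv _ hu, inner_smul_right, inner_smul_right, hξξ, inner_smul_left, ← hc]
  simp; ring

/-! ## §2 The unstable eigen-data of the perturbed block -/

/-- **THE UNSTABLE EIGEN-DATA OF A PERTURBED MODEL BLOCK.**  `‖ξ₀‖ = 1`, `A₀ ξ₀ = λ₀ ξ₀`, `ξ₀^⊥` `A₀`-invariant, `⟪A₀u, u⟫ ≤ β₀‖u‖²` on
`ξ₀^⊥`, `‖B‖ ≤ ε`, `36 ε ≤ λ₀ − β₀` ⟹ `A₀ + B` has `ξ, ℓ, λ, β` with `(A₀+B) ξ = λ ξ`, `ℓ ((A₀+B) v) = λ ℓ v`, `ℓ ξ = 1`,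
`⟪(A₀+B) v, v⟫ ≤ β‖v‖²` on `ker ℓ`, `β ≤ λ`, and `|λ − λ₀| ≤ 2ε`, `‖ξ − ξ₀‖ ≤ 6ε/(λ₀ − β₀)`, `β ≤ β₀ + 2ε`.
[cite: Kato1966, II §2.2 (eigenprojection of a perturbed simple eigenvalue); quantitative `C⁰` version] -/
theorem exists_unstableEigenData {A₀ B : E →L[ℝ] E} {ξ₀ : E} {lam₀ β₀ ε : ℝ} (hξ₀ : ‖ξ₀‖ = 1)
    (hA₀ξ₀ : A₀ ξ₀ = lam₀ • ξ₀) (hinv : ∀ u, ⟪ξ₀, u⟫_ℝ = 0 → ⟪ξ₀, A₀ u⟫_ℝ = 0)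
    (hnum : ∀ u, ⟪ξ₀, u⟫_ℝ = 0 → ⟪A₀ u, u⟫_ℝ ≤ β₀ * ‖u‖ ^ 2) (hγ : β₀ < lam₀)
    (hε : 0 ≤ ε) (hB : ‖B‖ ≤ ε) (hεγ : 36 * ε ≤ lam₀ - β₀) :
    ∃ (ξ : E) (ℓ : E →L[ℝ] ℝ) (lam β : ℝ), (A₀ + B) ξ = lam • ξ ∧ (∀ v, ℓ ((A₀ + B) v) = lam * ℓ v) ∧ ℓ ξ = 1 ∧
      (∀ v, ℓ v = 0 → ⟪(A₀ + B) v, v⟫_ℝ ≤ β * ‖v‖ ^ 2) ∧ β ≤ lam ∧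
      |lam - lam₀| ≤ 2 * ε ∧ ‖ξ - ξ₀‖ ≤ 6 * ε / (lam₀ - β₀) ∧ β ≤ β₀ + 2 * ε := by
  set γ : ℝ := lam₀ - β₀ with hγdef
  have hγ0 : 0 < γ := by rw [hγdef]; linarith
  have h16 : 16 * ε ≤ lam₀ - β₀ := by linarith
  have hξξ : ⟪ξ₀, ξ₀⟫_ℝ = 1 := by rw [real_inner_self_eq_norm_sq, hξ₀, one_pow]
  set A : E →L[ℝ] E := A₀ + B with hA
  -- right eigenvector
  obtain ⟨w, lam, hw0, hwn, hlam, hAξ⟩ := exists_eigenvector_of_norm_le hξ₀ hA₀ξ₀ hinv hnum hγ hε hB h16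
  -- left eigenvector: the same for the adjoints
  have hA₀'ξ₀ : (ContinuousLinearMap.adjoint A₀) ξ₀ = lam₀ • ξ₀ := adjoint_apply_eq_of_invariant hξ₀ hA₀ξ₀ hinv
  have hinv' : ∀ u, ⟪ξ₀, u⟫_ℝ = 0 → ⟪ξ₀, (ContinuousLinearMap.adjoint A₀) u⟫_ℝ = 0 := fun u hu => by
    rw [ContinuousLinearMap.adjoint_inner_right, hA₀ξ₀, inner_smul_left, hu]; simp
  have hnum' : ∀ u, ⟪ξ₀, u⟫_ℝ = 0 → ⟪(ContinuousLinearMap.adjoint A₀) u, u⟫_ℝ ≤ β₀ * ‖u‖ ^ 2 := fun u hu => by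
    rw [ContinuousLinearMap.adjoint_inner_left, real_inner_comm]; exact hnum u hu
  have hB' : ‖ContinuousLinearMap.adjoint B‖ ≤ ε := by rw [ContinuousLinearMap.adjoint.norm_map]; exact hB
  obtain ⟨w', lam', hw'0, hw'n, -, hA'z⟩ := exists_eigenvector_of_norm_le hξ₀ hA₀'ξ₀ hinv' hnum' hγ hε hB' h16
  have hadj : ContinuousLinearMap.adjoint A₀ + ContinuousLinearMap.adjoint B = ContinuousLinearMap.adjoint A := by
    rw [hA, map_add]
  rw [hadj] at hA'z
  set ξ : E := ξ₀ + w with hξ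
  set z : E := ξ₀ + w' with hz
  -- `⟪z, ξ⟫ = 1 + ⟪w', w⟫ ≥ 1/2`
  have hr : 6 * ε / (lam₀ - β₀) ≤ 1 / 6 := by
    rw [div_le_iff₀ hγ0]; linarith
  have hzξ : ⟪z, ξ⟫_ℝ = 1 + ⟪w', w⟫_ℝ := by
    rw [hz, hξ, inner_add_left, inner_add_right, inner_add_right, hξξ, hw0, real_inner_comm ξ₀ w', hw'0]; ring
  have hm : 1 / 2 ≤ ⟪z, ξ⟫_ℝ := by
    rw [hzξ]
    have h := abs_real_inner_le_norm w' w
    have h2 : ‖w'‖ * ‖w‖ ≤ (1 / 6) * (1 / 6) := mul_le_mul (hw'n.trans hr) (hwn.trans hr) (norm_nonneg _) (by norm_num)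
    have h3 : -(‖w'‖ * ‖w‖) ≤ ⟪w', w⟫_ℝ := by have := neg_abs_le ⟪w', w⟫_ℝ; linarith
    linarith
  have hm0 : 0 < ⟪z, ξ⟫_ℝ := by linarith
  -- the left eigenvector `ℓ = ⟪z, ·⟫ / ⟪z, ξ⟫`
  set ℓ : E →L[ℝ] ℝ := (⟪z, ξ⟫_ℝ)⁻¹ • innerSL ℝ z with hℓ
  have hℓapply : ∀ v, ℓ v = (⟪z, ξ⟫_ℝ)⁻¹ * ⟪z, v⟫_ℝ := fun v => by simp [hℓ]
  have hℓξ : ℓ ξ = 1 := by rw [hℓapply, inv_mul_cancel₀ hm0.ne']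
  have hℓA' : ∀ v, ℓ (A v) = lam' * ℓ v := fun v => by
    rw [hℓapply, hℓapply, ← ContinuousLinearMap.adjoint_inner_left, hA'z, inner_smul_left]; simp; ring
  -- `λ' = λ`
  have hll : lam' = lam := by
    have h1 : ℓ (A ξ) = lam := by rw [hAξ, map_smul, hℓξ, smul_eq_mul, mul_one]
    have h2 : ℓ (A ξ) = lam' := by rw [hℓA', hℓξ, mul_one]
    rw [← h2, h1]
  have hℓA : ∀ v, ℓ (A v) = lam * ℓ v := fun v => by rw [hℓA', hll]
  -- numerical range on `ker ℓ`
  set β : ℝ := β₀ + (lam₀ - β₀) * (6 * ε / (lam₀ - β₀)) ^ 2 + ε with hβdef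
  have hβle : β ≤ β₀ + 2 * ε := by
    have h1 : (lam₀ - β₀) * (6 * ε / (lam₀ - β₀)) ^ 2 = 36 * ε * ε / (lam₀ - β₀) := by
      field_simp; ring
    have h2 : 36 * ε * ε / (lam₀ - β₀) ≤ ε := by
      rw [div_le_iff₀ hγ0]; nlinarith
    rw [hβdef, h1]; linarith
  have hβlam : β ≤ lam := by
    have : lam₀ - 2 * ε ≤ lam := by have := neg_abs_le (lam - lam₀); have := hlam; linarith [abs_le.1 hlam]
    linarith
  have hnumA : ∀ v, ℓ v = 0 → ⟪A v, v⟫_ℝ ≤ β * ‖v‖ ^ 2 := by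
    intro v hv
    have hzv : ⟪z, v⟫_ℝ = 0 := by
      have h := hv; rw [hℓapply] at h
      exact (mul_eq_zero.1 h).resolve_left (inv_ne_zero hm0.ne')
    -- the `ξ₀`-component `c = ⟪ξ₀, v⟫ = −⟪w', v⟫`
    set c : ℝ := ⟪ξ₀, v⟫_ℝ with hc
    have hcw : c = -⟪w', v⟫_ℝ := by
      have h : ⟪z, v⟫_ℝ = c + ⟪w', v⟫_ℝ := by rw [hz, inner_add_left]
      linarith
    have hcb : |c| ≤ 6 * ε / (lam₀ - β₀) * ‖v‖ := by
      rw [hcw, abs_neg]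
      exact (abs_real_inner_le_norm w' v).trans (mul_le_mul_of_nonneg_right hw'n (norm_nonneg _))
    set u : E := v - c • ξ₀ with hu
    have hu0 : ⟪ξ₀, u⟫_ℝ = 0 := by rw [hu, inner_sub_right, inner_smul_right, hξξ, mul_one, hc, sub_self]
    have hvsplit : v = u + c • ξ₀ := by rw [hu]; abel
    -- Pythagoras
    have hpy : ‖v‖ ^ 2 = ‖u‖ ^ 2 + c ^ 2 := by
      have horth : ⟪u, c • ξ₀⟫_ℝ = 0 := by rw [inner_smul_right, real_inner_comm, hu0, mul_zero]
      have h := norm_add_sq_eq_norm_sq_add_norm_sq_of_inner_eq_zero u (c • ξ₀) horth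
      rw [← hvsplit, norm_smul, hξ₀, mul_one, Real.norm_eq_abs, abs_mul_abs_self] at h
      simp only [sq]; exact h
    -- `⟪A₀ v, v⟫ = ⟪A₀ u, u⟫ + λ₀ c²`
    have hA₀v : ⟪A₀ v, v⟫_ℝ = ⟪A₀ u, u⟫_ℝ + lam₀ * c ^ 2 := by
      have h1 : ⟪A₀ u, ξ₀⟫_ℝ = 0 := by rw [real_inner_comm, hinv u hu0]
      have h2 : ⟪ξ₀, u⟫_ℝ = 0 := hu0
      have hA₀v' : A₀ v = A₀ u + (c * lam₀) • ξ₀ := by rw [hvsplit, map_add, map_smul, hA₀ξ₀, smul_smul]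
      rw [hA₀v', hvsplit]
      simp only [inner_add_left, inner_add_right, inner_smul_left, inner_smul_right, h1, h2, hξξ, conj_trivial]
      ring
    have hBv : ⟪B v, v⟫_ℝ ≤ ε * ‖v‖ ^ 2 := by
      have h1 : ⟪B v, v⟫_ℝ ≤ ‖B v‖ * ‖v‖ := real_inner_le_norm _ _
      have h2 : ‖B v‖ ≤ ε * ‖v‖ := (B.le_opNorm v).trans (mul_le_mul_of_nonneg_right hB (norm_nonneg _))
      have h3 : ‖B v‖ * ‖v‖ ≤ ε * ‖v‖ * ‖v‖ := mul_le_mul_of_nonneg_right h2 (norm_nonneg _)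
      rw [sq, ← mul_assoc]; linarith
    have hc2 : c ^ 2 ≤ (6 * ε / (lam₀ - β₀)) ^ 2 * ‖v‖ ^ 2 := by
      have h := hcb
      have h0 : 0 ≤ 6 * ε / (lam₀ - β₀) * ‖v‖ := by positivity
      calc c ^ 2 = |c| ^ 2 := (sq_abs c).symm
        _ ≤ (6 * ε / (lam₀ - β₀) * ‖v‖) ^ 2 := pow_le_pow_left₀ (abs_nonneg c) h 2
        _ = (6 * ε / (lam₀ - β₀)) ^ 2 * ‖v‖ ^ 2 := by ring
    have happ : A v = A₀ v + B v := rfl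
    rw [happ, inner_add_left, hA₀v, hβdef]
    have e1 : ⟪A₀ u, u⟫_ℝ ≤ β₀ * ‖u‖ ^ 2 := hnum u hu0
    have e2 : β₀ * ‖u‖ ^ 2 = β₀ * ‖v‖ ^ 2 - β₀ * c ^ 2 := by rw [hpy]; ring
    have e3 : (lam₀ - β₀) * c ^ 2 ≤ (lam₀ - β₀) * (6 * ε / (lam₀ - β₀)) ^ 2 * ‖v‖ ^ 2 := by
      have h := mul_le_mul_of_nonneg_left hc2 hγ0.le
      rwa [← mul_assoc] at h
    linarith [e1, e2, e3, hBv]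
  refine ⟨ξ, ℓ, lam, β, hAξ, hℓA, hℓξ, hnumA, hβlam, hlam, ?_, hβle⟩
  rw [hξ, add_sub_cancel_left]; exact hwn

/-! ## §3 The unstable curve from MODEL data and a norm bound -/

/-- **THE `C¹` UNSTABLE CURVE FROM MODEL DATA.**  Let `f p = 0`, `Df` Lipschitz at `p` on `B(p, ρ₀)`, and let the MODEL block
`(A₀, ξ₀, λ₀, β₀)` be orthogonally split as in `exists_unstableEigenData` with `‖Df(p) − A₀‖ ≤ ε`, `36 ε ≤ λ₀ − β₀`, `2 ε < λ₀`.  Then there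
are the unstable eigen-data `ξ, λ` of `Df(p)` (`‖ξ − ξ₀‖ ≤ 6ε/(λ₀ − β₀)`, `|λ − λ₀| ≤ 2ε`, `λ > 0`) and, for every `R > 0`, `δ > 0`, `C₁ ≥ 0`
and `P, P′` with `P(0) = p`, `P′(0) = ξ`, `HasDerivAt P (P′ s) s`, `P′` continuous and `λ s · P′(s) = f(P(s))` on `(−δ, δ)`,
`‖P(s) − p − sξ‖ ≤ min (R|s|) (C₁ s²)`, `‖P′(s) − ξ‖ ≤ C₁|s|`, `P(s) ∈ B(p, ρ₀)` — the hypotheses K checks at the waist zero by name.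
[cite: CoddingtonLevinson1955, Ch. 13 Thm 4.1; parameterization form] -/
theorem exists_unstableCurve_of_model {f : E → E} {f' : E → E →L[ℝ] E} {A₀ : E →L[ℝ] E} {p ξ₀ : E}
    {lam₀ β₀ ε ω ρ₀ R : ℝ} (hξ₀ : ‖ξ₀‖ = 1) (hA₀ξ₀ : A₀ ξ₀ = lam₀ • ξ₀)
    (hinv : ∀ u, ⟪ξ₀, u⟫_ℝ = 0 → ⟪ξ₀, A₀ u⟫_ℝ = 0) (hnum : ∀ u, ⟪ξ₀, u⟫_ℝ = 0 → ⟪A₀ u, u⟫_ℝ ≤ β₀ * ‖u‖ ^ 2)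
    (hγ : β₀ < lam₀) (hε : 0 ≤ ε) (hB : ‖f' p - A₀‖ ≤ ε) (hεγ : 36 * ε ≤ lam₀ - β₀) (hεlam : 2 * ε < lam₀)
    (hω : 0 ≤ ω) (hρ₀ : 0 < ρ₀) (hR : 0 < R)
    (hf0 : f p = 0) (hfd : ∀ y ∈ ball p ρ₀, HasFDerivAt f (f' y) y) (hlip : ∀ y ∈ ball p ρ₀, ‖f' y - f' p‖ ≤ ω * ‖y - p‖) :
    ∃ (ξ : E) (lam : ℝ), f' p ξ = lam • ξ ∧ ‖ξ - ξ₀‖ ≤ 6 * ε / (lam₀ - β₀) ∧ |lam - lam₀| ≤ 2 * ε ∧ 0 < lam ∧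
      ∃ δ C₁ : ℝ, ∃ P P' : ℝ → E, 0 < δ ∧ 0 ≤ C₁ ∧ P 0 = p ∧ P' 0 = ξ ∧
        (∀ s ∈ Ioo (-δ) δ, HasDerivAt P (P' s) s) ∧ ContinuousOn P' (Ioo (-δ) δ) ∧
        (∀ s ∈ Ioo (-δ) δ, (lam * s) • P' s = f (P s)) ∧
        (∀ s ∈ Ioo (-δ) δ, ‖P s - p - s • ξ‖ ≤ R * |s|) ∧
        (∀ s ∈ Ioo (-δ) δ, ‖P s - p - s • ξ‖ ≤ C₁ * s ^ 2) ∧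
        (∀ s ∈ Ioo (-δ) δ, ‖P' s - ξ‖ ≤ C₁ * |s|) ∧
        (∀ s ∈ Ioo (-δ) δ, P s ∈ ball p ρ₀) := by
  have hsplit : A₀ + (f' p - A₀) = f' p := by abel
  obtain ⟨ξ, ℓ, lam, β, hAξ, hℓA, hℓξ, hnumA, hβlam, hlam, hξn, -⟩ :=
    exists_unstableEigenData (B := f' p - A₀) hξ₀ hA₀ξ₀ hinv hnum hγ hε hB hεγ
  rw [hsplit] at hAξ hℓA hnumA
  have hlam0 : 0 < lam := by
    have := abs_le.1 hlam; linarith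
  refine ⟨ξ, lam, hAξ, hξn, hlam, hlam0, ?_⟩
  exact exists_unstableCurve_of_leftEigenvector hlam0 hβlam hω hρ₀ hR hf0 hfd hlip hAξ hℓA hℓξ hnumA

/-- **THE UNSTABLE STREAMLINE FROM MODEL DATA** (appended 2026-08-29, same hand).  Under the hypotheses of `exists_unstableCurve_of_model`
(MODEL block `(A₀, ξ₀, λ₀, β₀)` orthogonally split, `‖Df(p) − A₀‖ ≤ ε`, `36 ε ≤ λ₀ − β₀`, `2 ε < λ₀`, `f p = 0`, `Df` Lipschitz at `p`):
there are the unstable eigen-data `ξ, λ` of `Df(p)` (`‖ξ − ξ₀‖ ≤ 6ε/(λ₀−β₀)`, `|λ − λ₀| ≤ 2ε`, `λ > 0`), `δ > 0` and `P` with `P(0) = p`,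
`P′(0) = ξ`, `P((−δ, δ)) ⊆ B(p, ρ₀)`, such that for every `s₀ ∈ (−δ, δ)` the curve `t ↦ P(s₀ e^{λt})` solves `x′ = f(x)` for `t ≤ 0` and
tends to `p` as `t → −∞` — the unstable streamline through the waist zero, by name, from what K checks.
[cite: KaliesKepleyJames2017, §3 Lemma 3.1; CoddingtonLevinson1955, Ch. 13 Thm 4.1] -/
theorem exists_unstableCurve_trajectory_of_model {f : E → E} {f' : E → E →L[ℝ] E} {A₀ : E →L[ℝ] E} {p ξ₀ : E}
    {lam₀ β₀ ε ω ρ₀ : ℝ} (hξ₀ : ‖ξ₀‖ = 1) (hA₀ξ₀ : A₀ ξ₀ = lam₀ • ξ₀)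
    (hinv : ∀ u, ⟪ξ₀, u⟫_ℝ = 0 → ⟪ξ₀, A₀ u⟫_ℝ = 0) (hnum : ∀ u, ⟪ξ₀, u⟫_ℝ = 0 → ⟪A₀ u, u⟫_ℝ ≤ β₀ * ‖u‖ ^ 2)
    (hγ : β₀ < lam₀) (hε : 0 ≤ ε) (hB : ‖f' p - A₀‖ ≤ ε) (hεγ : 36 * ε ≤ lam₀ - β₀) (hεlam : 2 * ε < lam₀)
    (hω : 0 ≤ ω) (hρ₀ : 0 < ρ₀)
    (hf0 : f p = 0) (hfd : ∀ y ∈ ball p ρ₀, HasFDerivAt f (f' y) y) (hlip : ∀ y ∈ ball p ρ₀, ‖f' y - f' p‖ ≤ ω * ‖y - p‖) :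
    ∃ (ξ : E) (lam : ℝ), f' p ξ = lam • ξ ∧ ‖ξ - ξ₀‖ ≤ 6 * ε / (lam₀ - β₀) ∧ |lam - lam₀| ≤ 2 * ε ∧ 0 < lam ∧
      ∃ δ : ℝ, ∃ P : ℝ → E, 0 < δ ∧ P 0 = p ∧ HasDerivAt P ξ 0 ∧ (∀ s ∈ Ioo (-δ) δ, P s ∈ ball p ρ₀) ∧
        ∀ s₀ ∈ Ioo (-δ) δ,
          (∀ t : ℝ, t ≤ 0 → HasDerivAt (fun τ => P (s₀ * Real.exp (lam * τ))) (f (P (s₀ * Real.exp (lam * t)))) t) ∧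
          Tendsto (fun t => P (s₀ * Real.exp (lam * t))) atBot (𝓝 p) := by
  have hsplit : A₀ + (f' p - A₀) = f' p := by abel
  obtain ⟨ξ, ℓ, lam, β, hAξ, hℓA, hℓξ, hnumA, hβlam, hlam, hξn, -⟩ :=
    exists_unstableEigenData (B := f' p - A₀) hξ₀ hA₀ξ₀ hinv hnum hγ hε hB hεγ
  rw [hsplit] at hAξ hℓA hnumA
  have hlam0 : 0 < lam := by
    have := abs_le.1 hlam; linarith
  refine ⟨ξ, lam, hAξ, hξn, hlam, hlam0, ?_⟩
  exact exists_unstableCurve_trajectory_of_leftEigenvector hlam0 hβlam hω hρ₀ hf0 hfd hlip hAξ hℓA hℓξ hnumA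

end Summit.NavierStokesRegularity.NavierStokesRegularity.Theorems.SkeletonJ1RUnstableCurve

end
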